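import Literature.AlgebraicGeometry.HodgeTheory.RestrictionImageOfCompactification
import Summits.HodgeConjecture.HodgeConjecture.Theorems.LinearSystemTorelliMiddleDivisorSupportFourfoldOfLineResidueOfTypeStability
import HarnessLib

/-!
# Route `LinearSystemTorelli` — `DeligneGlobalInvariantCycles` (stmt-HodgeConjecture-16363; stub D of the
line `IdeatorFiveSketch` of crux stmt-HodgeConjecture-2409) from Voisin II Prop. 4.23 alone

Helper file (`--supports` stmt-HodgeConjecture-2409, registered sub-goal; it closes nothing). The route
decl `Theses.LinearSystemTorelli.DeligneGlobalInvariantCycles` — Deligne's théorème de la partie fixe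
(Hodge II, Thm. 4.1.1), item stmt-16363, shared with route `PeriodDeficiency`, and stub D of the
skeleton `Cruxes/MiddleDivisorSupportFourfold/Lines/IdeatorFiveSketch.lean` — is by `Iff.rfl` the
Literature named fact `deligne_globalInvariantCycles`, whose residue the tree's unit had brought to
{Voisin II Thm. 4.18 (PROVED: `deligne1968_invariantClass_fromTotalSpace_holds`), a package of mixed
Hodge structures with Hodge II 3.2.17}. Since `RestrictionImageOfCompactification.lean` (lead c14)
the second input is ONE printed proposition, the named fact
`voisin2003_rangeRestrict_eq_of_compactification` (Voisin II Prop. 4.23), and this file records the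
resulting closure path of the ITEM by name:

* `linearSystemTorelli_deligneGlobalInvariantCycles_of_rangeRestrict` —
  `voisin2003_rangeRestrict_eq_of_compactification → Theses.LinearSystemTorelli.DeligneGlobalInvariantCycles`;
* `linearSystemTorelli_middleDivisorSupportFourfold_of_lineResidue_of_rangeRestrict` — the line's residue
  with two PRINTED classical debts: T → HC/`ℚ̄` (stmt-11596) → `riemannExistence_finiteCovering` (SGA1 XII 5.1) →
  `voisin2003_rangeRestrict_eq_of_compactification` (Voisin II Prop. 4.23) → crux.

So stmt-16363 (and stub D) close by
`linearSystemTorelli_deligneGlobalInvariantCycles_of_rangeRestrict voisin2003_rangeRestrict_eq_of_compactification_holds`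
the day that proposition is discharged.
-/

-- every declaration of this problem lives in `Summit.HodgeConjecture.HodgeConjecture.…`
set_option linter.dupNamespace false

namespace Summit.HodgeConjecture.HodgeConjecture.Theorems

open CategoryTheory AlgebraicGeometry
open Literature.AlgebraicGeometry Literature.AlgebraicGeometry.Motives
open Literature.AlgebraicGeometry.HodgeTheory
open Literature.AlgebraicTopology.SingularHomology

/-- **The partie fixe item from Voisin II Prop. 4.23 alone.** The route decl
`Theses.LinearSystemTorelli.DeligneGlobalInvariantCycles` (stmt-HodgeConjecture-16363 = the named fact
`deligne_globalInvariantCycles`, Deligne Hodge II Thm. 4.1.1 = Voisin II Thm. 4.24, by `Iff.rfl`)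
follows from the named fact `voisin2003_rangeRestrict_eq_of_compactification` (Voisin II Prop. 4.23:
for closed smooth projective `Y ⊂ 𝒳 ⊂ 𝒳̄`, `𝒳̄` a smooth projective compactification, the images of
`Hᵏ(𝒳̄; ℚ)` and `Hᵏ(𝒳; ℚ)` in `Hᵏ(Y; ℚ)` agree) — the tree's
`deligne_globalInvariantCycles_of_rangeRestrict` (Thm. 4.18 PROVED as
`deligne1968_invariantClass_fromTotalSpace_holds`; Prop. 4.23 applied to `𝒳_{s₀} ⊂ 𝒳 ⊂ 𝒳̄`; the
`ℚ → ℂ` comparison `exists_complexBetti_map_fiberι_eq_of_rat`; `deligne_globalInvariantCycles_assembly`).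
[cite: VoisinHodgeII2003, Thm. 4.18, Prop. 4.23 and Thm. 4.24] [cite: DeligneHodgeII1971, Théorème 4.1.1] -/
theorem linearSystemTorelli_deligneGlobalInvariantCycles_of_rangeRestrict :
    Literature.AlgebraicGeometry.HodgeTheory.voisin2003_rangeRestrict_eq_of_compactification →
    Theses.LinearSystemTorelli.DeligneGlobalInvariantCycles :=
  fun h ↦ Literature.AlgebraicGeometry.HodgeTheory.deligne_globalInvariantCycles_of_rangeRestrict h

/-- **The line's residue with two PRINTED classical debts** (lead c14). The crux
`LinearSystemTorelli.MiddleDivisorSupportFourfold` (every rational `(2,2)`-class on a smooth projective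
complex fourfold lies in `N¹H⁴`) follows from the two open inputs of the line — T (type stability of
`(2,2)` loop-continuations at `ℚ̄`-generic points of `ℚ̄`-families of fourfolds; stub A') and the
Hodge conjecture over `ℚ̄` (`PeriodDeficiency.HodgeConjectureQbar`, stmt-11596, of which only the
codimension-2 slice is used) — modulo exactly two printed theorems now both present in the tree as
single named facts: Riemann's existence theorem over `ℂ` in covering form
(`FundamentalGroup.riemannExistence_finiteCovering`, SGA1 XII Thm. 5.1; stub C1) and Voisin II
Prop. 4.23 (`voisin2003_rangeRestrict_eq_of_compactification`; from which Deligne's partie fixe =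
stub D = stmt-16363 follows, `deligne_globalInvariantCycles_of_rangeRestrict`). This is p127811's
`linearSystemTorelli_middleDivisorSupportFourfold_of_lineResidue_of_typeStability` with its partie-fixe
hypothesis discharged down to Prop. 4.23. [cite: Voisin2007HodgeLoci, §3, proof of Prop. 0.7]
[cite: VoisinHodgeII2003, Prop. 4.23 and Thm. 4.24] [cite: SGA1, Exp. XII Thm. 5.1] -/
theorem linearSystemTorelli_middleDivisorSupportFourfold_of_lineResidue_of_rangeRestrict :
    (∀ (σ : AlgebraicClosure ℚ →+* ℂ) ⦃𝒳₀ S₀ : SchemeOver (AlgebraicClosure ℚ)⦄ (f₀ : 𝒳₀ ⟶ S₀),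
    IsQuasiProjectiveOver 𝒳₀ → IsQuasiProjectiveOver S₀ → IrreducibleSpace S₀.left →
    AlgebraicGeometry.Smooth S₀.hom → IsSmoothProjectiveFamily ((baseChangeHom σ).map f₀) 4 → ∀ (s :
    ComplexPoints ((baseChangeHom σ).obj S₀)), closure {(baseChangeHomFst σ S₀).base s.pt} =
    (Set.univ : Set S₀.left) → ∀ (α : complexBetti (fiberOver ((baseChangeHom σ).map f₀) s) 4),
    IsRationalClass α → IsOfHodgeType 4 (fiberOver ((baseChangeHom σ).map f₀) s) 4 2 2 α → ∀ (γ :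
    Path s s) (β : complexBetti (fiberOver ((baseChangeHom σ).map f₀) s) 4), IsContinuationAlong γ α
    β → IsOfHodgeType 4 (fiberOver ((baseChangeHom σ).map f₀) s) 4 2 2 β) →
    Summit.HodgeConjecture.HodgeConjecture.Theses.PeriodDeficiency.HodgeConjectureQbar →
    Literature.AlgebraicGeometry.FundamentalGroup.riemannExistence_finiteCovering →
    Literature.AlgebraicGeometry.HodgeTheory.voisin2003_rangeRestrict_eq_of_compactification →
    Summit.HodgeConjecture.HodgeConjecture.Theses.LinearSystemTorelli.MiddleDivisorSupportFourfold := by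
  intro hT hQ hR hV
  exact linearSystemTorelli_middleDivisorSupportFourfold_of_lineResidue_of_typeStability hT hQ hR
    (Literature.AlgebraicGeometry.HodgeTheory.deligne_globalInvariantCycles_of_rangeRestrict hV)

end Summit.HodgeConjecture.HodgeConjecture.Theorems
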